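import Summits.ResolutionOfSingularities.ResolutionOfSingularities.Theorems.HilbertSamuelEliminationSigmaMaxModificationsCorridor3ConfinementLocalDim
import Literature.AlgebraicGeometry.Resolution.BlowupSequencesComapMarked
import HarnessLib

/-!
# Route `HilbertSamuelElimination`, crux `SigmaMaxModificationsCorridor3`
# (stmt-ResolutionOfSingularities-19249; child of `SigmaMaxModifications` stmt-…-18506),
# line `tame_wild` v3: CONFINEMENT ladder, row C4 (second half) — the LOCAL TOWER at `ξ` is the
# induced blow-up sequence along `Spec 𝒪_{Y,ξ} → Y`

[OURS · L1 W4.2] Row C4 of `L/w42/CHAIN.md` v3.1 §5 (stub-1: "blow-up commutes with the flat base change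
`Spec 𝒪_{Y,ξ} → Y` … lifts a `CentreSeq` on `Y_n` to one on `W` and identifies tops"), in the tree's
vocabulary of INDUCED SEQUENCES (`CentreSeq.comap`, `CentreSeq.comapι`, `CentreSeq.isPullback_comap` of
`Literature/…/BlowupSequencesComapMarked.lean`, BGMW Thm. 8.0.5 / GW Prop. 13.91 (2)): for a blow-up
sequence `s` on `Y` and `ι = Spec 𝒪_{Y,ξ} → Y` (flat, tree `flat_fromSpecStalk`), the induced sequence
`s^*ι := s.comap ι` on `Spec 𝒪_{Y,ξ}` (centres pulled back) has top `(s^*ι).top` CARTESIAN over `s.top`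
(`isPullback_comap`), i.e. `(s^*ι).top ≅ s.top ×_Y Spec 𝒪_{Y,ξ} = W`; the comparison morphism
`s.comapι ι : (s^*ι).top → s.top` is a flat preimmersion, induces isomorphisms of local rings, preserves
the Hilbert–Samuel functions, has image the points of `s.top` over generisations of `ξ`, and
`dim (s^*ι).top ≤ dim 𝒪_{Y,ξ}` (C3b). So the round lemma C5 can run the printed surface theorems on the
honest blow-up sequence `s^*ι` of the local scheme and read everything back on `s.top`. NOT a
statement of any manuscript.

## Sources

* U. Görtz, T. Wedhorn, *Algebraic Geometry I*, 2nd ed. (2020), Prop. 13.91 (2). [GortzWedhorn2020]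
* The Stacks Project, Tags 0805, 01J7. [StacksProject]
* E. Bierstone, D. Grigoriev, P. Milman, J. Włodarczyk, arXiv:1206.3090, Thm. 8.0.5.
  [BierstoneGrigorievMilmanWlodarczyk2011]
-/

set_option linter.dupNamespace false -- mandated namespace of this single-conjunct summit

noncomputable section

open CategoryTheory CategoryTheory.Limits AlgebraicGeometry TopologicalSpace Topology Order
open Literature.AlgebraicGeometry.Resolution Literature.RingTheory.HilbertSamuel

namespace Summit.ResolutionOfSingularities.ResolutionOfSingularities.Theorems.SigmaMaxModificationsCorridor3.Helpers

universe u

variable {Y : Scheme.{u}} (s : CentreSeq Y) (ξ : Y)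

/-- **C4: the top of the induced sequence along `Spec 𝒪_{Y,ξ} → Y` is cartesian over the top**:
`(s^*ι).top ≅ s.top ×_Y Spec 𝒪_{Y,ξ}` (GW Prop. 13.91 (2) down the tower — tree
`CentreSeq.isPullback_comap` — for the flat `ι`). [OURS · L1 W4.2] row C4 of CHAIN v3.1; NOT a
statement of the manuscript. [cite: GortzWedhorn2020, Prop. 13.91 (2)] [cite: StacksProject, Tag 0805] -/
theorem isPullback_comap_fromSpecStalk :
    IsPullback (s.comapι (Y.fromSpecStalk ξ)) (s.comap (Y.fromSpecStalk ξ)).comp s.comp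
      (Y.fromSpecStalk ξ) := by
  haveI := flat_fromSpecStalk Y ξ
  exact s.isPullback_comap (Y.fromSpecStalk ξ)

/-- The comparison morphism `(s^*ι).top → s.top` of the local tower is flat. [folklore] -/
theorem flat_comapι_fromSpecStalk : Flat (s.comapι (Y.fromSpecStalk ξ)) := by
  haveI := flat_fromSpecStalk Y ξ
  exact s.flat_comapι (Y.fromSpecStalk ξ)

/-- The comparison morphism `(s^*ι).top → s.top` of the local tower is a preimmersion (base change of
the preimmersion `Spec 𝒪_{Y,ξ} → Y`). [cite: StacksProject, Tag 01J7] -/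
theorem isPreimmersion_comapι_fromSpecStalk : IsPreimmersion (s.comapι (Y.fromSpecStalk ξ)) :=
  MorphismProperty.of_isPullback (P := @IsPreimmersion) (isPullback_comap_fromSpecStalk s ξ).flip
    inferInstance

/-- **The local tower has the local rings of the tower**: `(s^*ι).top → s.top` induces isomorphisms
of local rings (a flat preimmersion, tree `isIso_stalkMap_of_flat_of_isPreimmersion`).
[cite: StacksProject, Tag 01J7] -/
theorem isIso_stalkMap_comapι_fromSpecStalk (w : ↑(s.comap (Y.fromSpecStalk ξ)).top) :
    IsIso ((s.comapι (Y.fromSpecStalk ξ)).stalkMap w) := by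
  haveI := flat_comapι_fromSpecStalk s ξ
  haveI := isPreimmersion_comapι_fromSpecStalk s ξ
  exact isIso_stalkMap_of_flat_of_isPreimmersion _ w

/-- **Hilbert–Samuel functions along the local tower**: `H^N_{(s^*ι).top}(w) = H^N_{s.top}(w)`
(`Y` locally Noetherian). [cite: CossartJannsenSaito2020, Def. 2.28] -/
theorem hsFun_comap_top_fromSpecStalk [IsLocallyNoetherian Y] (N : ℕ)
    (w : ↑(s.comap (Y.fromSpecStalk ξ)).top) :
    Scheme.hsFun (s.comap (Y.fromSpecStalk ξ)).top N w =
      Scheme.hsFun s.top N ((s.comapι (Y.fromSpecStalk ξ)).base w) := by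
  haveI : IsLocallyNoetherian s.top := by
    haveI : IsProper s.comp := s.isProper_comp
    exact LocallyOfFiniteType.isLocallyNoetherian s.comp
  haveI := isIso_stalkMap_comapι_fromSpecStalk s ξ w
  exact Scheme.hsFun_eq_of_isIso_stalkMap (s.comapι (Y.fromSpecStalk ξ)) N w

/-- **Strata along the local tower**: the `ν`-stratum of `(s^*ι).top` is the preimage of that of
`s.top`. [cite: CossartJannsenSaito2020, Def. 2.28] -/
theorem hsStratum_comap_top_fromSpecStalk [IsLocallyNoetherian Y] (N : ℕ) (ν : ℕ → ℕ) :
    Scheme.hsStratum (s.comap (Y.fromSpecStalk ξ)).top N ν =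
      (fun w => (s.comapι (Y.fromSpecStalk ξ)).base w) ⁻¹' Scheme.hsStratum s.top N ν := by
  ext w
  rw [Set.mem_preimage, Scheme.mem_hsStratum_iff, Scheme.mem_hsStratum_iff,
    hsFun_comap_top_fromSpecStalk]

/-- **The points of the local tower** are the points of `s.top` over generisations of `ξ`.
[cite: StacksProject, Tag 01J7] -/
theorem range_comapι_fromSpecStalk :
    Set.range (s.comapι (Y.fromSpecStalk ξ)) = {x' | s.comp.base x' ⤳ ξ} := by
  have sq := isPullback_comap_fromSpecStalk s ξ
  have h1 : Set.range (s.comapι (Y.fromSpecStalk ξ)) =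
      Set.range (pullback.fst s.comp (Y.fromSpecStalk ξ)) := by
    have hsurj : Function.Surjective sq.isoPullback.hom.base :=
      (Scheme.homeoOfIso sq.isoPullback).surjective
    rw [← sq.isoPullback_hom_fst, Scheme.Hom.comp_base, TopCat.coe_comp, Set.range_comp,
      hsurj.range_eq, Set.image_univ]
  rw [h1, range_pullback_fst_fromSpecStalk]

/-- **C3b for the local tower**: `dim (s^*ι).top ≤ dim 𝒪_{Y,ξ}`. [cite: Matsumura1987, Thm. 15.5] -/
theorem topologicalKrullDim_comap_top_fromSpecStalk_le [IsLocallyNoetherian Y] :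
    topologicalKrullDim (s.comap (Y.fromSpecStalk ξ)).top ≤ ringKrullDim (Y.presheaf.stalk ξ) := by
  have sq := isPullback_comap_fromSpecStalk s ξ
  have e : topologicalKrullDim ↑(s.comap (Y.fromSpecStalk ξ)).top =
      topologicalKrullDim ↑(pullback s.comp (Y.fromSpecStalk ξ)) :=
    IsHomeomorph.topologicalKrullDim_eq _ (Scheme.homeoOfIso sq.isoPullback).isHomeomorph
  rw [e]
  exact topologicalKrullDim_pullback_comp_fromSpecStalk_le s ξ

end Summit.ResolutionOfSingularities.ResolutionOfSingularities.Theorems.SigmaMaxModificationsCorridor3.Helpers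

end
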